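import Summits.KontsevichZagierPeriods.KontsevichZagierPeriods.Theorems.RootDecompZetaThreeFrontierWordRungTwoP9a

/-! # `RootDecompZetaThreeFrontierWordRungTwoP9` — part 2/2 of the mechanical ≤200-line split of `P9src.lean`
(split by the decomp-kz census seat for landing; mathematics unchanged; part 2 continues part 1). -/

noncomputable section

namespace Summit.KontsevichZagierPeriods.RootDecompZetaThreeFrontier.WordLayer
open Set MeasureTheory MvPolynomial
open Literature.NumberTheory.Transcendental
open Summit.KontsevichZagierPeriods.KontsevichZagierPeriods.Theses.RootDecompZetaThreeFrontier
  (HigherWeightDescent)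
open Summit.KontsevichZagierPeriods.KontsevichZagierPeriods.Theses.LinRedNormalForm
  (DihedralNormalForm MzvKernelInKZ HoffmanSpanInKZ HoffmanIndependence)

section Necessity

open Literature.ModelTheory.ExponentialFields (IsSemialgebraic)














/-! (private copy of `strictAnti_fin_one` — dedup.landed / split policy; origin part RootDecompZetaThreeFrontierWordRungTwoP1) -/
/-- Auxiliary step `strictAnti_fin_one`. [bookkeeping] -/
private theorem strictAnti_fin_one (y : Fin 1 → ℝ) : StrictAnti y := fun a b hab =>
  absurd hab (by rw [Subsingleton.elim a b]; exact lt_irrefl _)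

/-! (private copy of `mem_simplex_one_iff` — dedup.landed / split policy; origin part RootDecompZetaThreeFrontierWordRungTwoP1) -/
/-- Membership in `simplex_one_iff`, unfolded. [bookkeeping] -/
private theorem mem_simplex_one_iff (y : Fin 1 → ℝ) : y ∈ KZ.openOrderedSimplex 1 ↔ 0 < y 0 ∧ y 0 < 1 := by
  constructor
  · rintro ⟨h0, h1, -⟩
    exact ⟨h0 0, h1 0⟩
  · rintro ⟨h0, h1⟩
    refine ⟨fun i => ?_, fun i => ?_, strictAnti_fin_one y⟩
    · rw [Fin.fin_one_eq_zero i]; exact h0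
    · rw [Fin.fin_one_eq_zero i]; exact h1

/-! (private copy of `mem_simplex_two_iff` — dedup.landed / split policy; origin part RootDecompZetaThreeFrontierWordRungTwoP1) -/
/-- Membership in `simplex_two_iff`, unfolded. [bookkeeping] -/
private theorem mem_simplex_two_iff (z : Fin 2 → ℝ) :
    z ∈ KZ.openOrderedSimplex 2 ↔ 0 < z 1 ∧ z 1 < z 0 ∧ z 0 < 1 := by
  constructor
  · rintro ⟨h0, h1, ha⟩
    exact ⟨h0 1, ha (show (0 : Fin 2) < 1 by decide), h1 0⟩
  · rintro ⟨h1, h10, h0⟩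
    refine ⟨Fin.forall_fin_two.mpr ⟨h1.trans h10, h1⟩, Fin.forall_fin_two.mpr ⟨h0, h10.trans h0⟩,
      Fin.strictAnti_iff_succ_lt.mpr (Fin.forall_fin_one.mpr ?_)⟩
    simpa using h10

/-! (private copy of `continuous_snoc` — dedup.landed / split policy; origin part RootDecompZetaThreeFrontierWordRungTwoP2) -/
/-- `t ↦ Fin.snoc x t` is continuous. [folklore] (verbatim private copy, `Theorems/…SupportCollapse`) -/
private theorem continuous_snoc {N : ℕ} (x : Fin N → ℝ) :
    Continuous fun t : ℝ => (Fin.snoc x t : Fin (N + 1) → ℝ) := by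
  refine continuous_pi fun j => ?_
  refine Fin.lastCases ?_ (fun i => ?_) j
  · simpa using continuous_id'
  · simpa using continuous_const

/-! (private copy of `exists_measurableEquiv_snoc` — dedup.landed / split policy; origin part RootDecompZetaThreeFrontierWordRungTwoP2) -/
/-- Splitting off the last coordinate, `ℝ^{N+1} ≃ ℝ^N × ℝ`, as a volume-preserving measurable
equivalence with inverse `(x, t) ↦ Fin.snoc x t`. [folklore] (verbatim private copy) -/
private theorem exists_measurableEquiv_snoc (N : ℕ) :
    ∃ e : (Fin (N + 1) → ℝ) ≃ᵐ (Fin N → ℝ) × ℝ,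
      MeasurePreserving e volume ((volume : Measure (Fin N → ℝ)).prod (volume : Measure ℝ)) ∧
      ∀ q, e.symm q = Fin.snoc q.1 q.2 := by
  refine ⟨(MeasurableEquiv.piFinSuccAbove (fun _ => ℝ) (Fin.last N)).trans
    MeasurableEquiv.prodComm, ?_, fun q => ?_⟩
  · refine (volume_preserving_piFinSuccAbove (fun _ => ℝ) (Fin.last N)).trans ?_
    rw [Measure.volume_eq_prod]
    exact Measure.measurePreserving_swap
  · show (MeasurableEquiv.piFinSuccAbove (fun _ => ℝ) (Fin.last N)).symm (q.2, q.1) = _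
    rw [MeasurableEquiv.piFinSuccAbove_symm_apply, Fin.insertNthEquiv_last]
    rfl

/-! (private copy of `not_integrableOn_pole` — dedup.landed / split policy; origin part RootDecompZetaThreeFrontierWordRungTwoP3) -/
/-- pole test at `0`: if `m ≤ |M y|` on `(0, η)` with `0 < m`, `0 < η ≤ 1` and `1 ≤ b`, then
`y ↦ M y / y ^ b` is not integrable on `(0, η)` (comparison with `y⁻¹ = y ^ (-1 : ℝ)`). -/
private theorem not_integrableOn_pole {M : ℝ → ℝ} {m η : ℝ} {b : ℕ} (hm : 0 < m) (hη : 0 < η)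
    (hη1 : η ≤ 1) (hb : 1 ≤ b) (hM : ∀ y ∈ Ioo 0 η, m ≤ |M y|) :
    ¬ IntegrableOn (fun y => M y / y ^ b) (Ioo 0 η) := by
  intro h
  have hinv : IntegrableOn (fun y : ℝ => y⁻¹) (Ioo 0 η) := by
    refine Integrable.mono' (h.integrable.norm.const_mul m⁻¹) measurable_inv.aestronglyMeasurable
      ((ae_restrict_iff' measurableSet_Ioo).2 (Filter.Eventually.of_forall fun y hy => ?_))
    have hy0 : 0 < y := hy.1
    have hy1 : y ≤ 1 := hy.2.le.trans hη1
    have hyb : y ^ b ≤ y := by simpa using pow_le_pow_of_le_one hy0.le hy1 hb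
    have key : m / y ≤ |M y| / y ^ b := div_le_div₀ (abs_nonneg _) (hM y hy) (pow_pos hy0 b) hyb
    rw [Real.norm_eq_abs, abs_inv, abs_of_pos hy0, Real.norm_eq_abs, abs_div,
      abs_of_pos (pow_pos hy0 b)]
    calc y⁻¹ = m⁻¹ * (m / y) := by field_simp
      _ ≤ m⁻¹ * (|M y| / y ^ b) := mul_le_mul_of_nonneg_left key (inv_nonneg.2 hm.le)
  have h' : IntegrableOn (fun y : ℝ => y ^ (-1 : ℝ)) (Ioo 0 η) :=
    hinv.congr_fun (fun y _ => (Real.rpow_neg_one y).symm) measurableSet_Ioo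
  have := (intervalIntegral.integrableOn_Ioo_rpow_iff (s := -1) hη).1 h'
  exact lt_irrefl _ this

/-! (private copy of `abs_ge_near_zero` — dedup.landed / split policy; origin part RootDecompZetaThreeFrontierWordRungTwoP3) -/
/-- a function continuous at `0` with `M 0 ≠ 0` stays bounded below in absolute value near `0` -/
private theorem abs_ge_near_zero {M : ℝ → ℝ} (hM : ContinuousAt M 0) (h0 : M 0 ≠ 0) :
    ∃ η : ℝ, 0 < η ∧ η ≤ 1 ∧ ∀ y ∈ Ioo 0 η, |M 0| / 2 ≤ |M y| := by
  have hε : 0 < |M 0| / 2 := half_pos (abs_pos.2 h0)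
  obtain ⟨δ, hδ, hδ'⟩ := Metric.continuousAt_iff.1 hM _ hε
  refine ⟨min δ 1, lt_min hδ one_pos, min_le_right _ _, fun y hy => ?_⟩
  have hyδ : dist y 0 < δ := by
    rw [Real.dist_eq, sub_zero, abs_of_pos hy.1]
    exact hy.2.trans_le (min_le_left _ _)
  have h1 := hδ' hyδ
  rw [Real.dist_eq] at h1
  have h2 := abs_sub_abs_le_abs_sub (M 0) (M y)
  rw [abs_sub_comm] at h2
  linarith

/-! (private copy of `measurableSet_simplex` — dedup.landed / split policy; origin part RootDecompZetaThreeFrontierWordRungTwoP4a) -/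
/-- `simplex` is measurable. [bookkeeping] -/
private theorem measurableSet_simplex (k : ℕ) : MeasurableSet (KZ.openOrderedSimplex k) :=
  IsSemialgebraic.measurableSet_holds (KZ.isSemialgebraic_openOrderedSimplex k)

/-! (private copy of `ae_integrableOn_snoc` — dedup.landed / split policy; origin part RootDecompZetaThreeFrontierWordRungTwoP4) -/
/-- Fubini: the last-coordinate sections of an integrable function are a.e. integrable. -/
private theorem ae_integrableOn_snoc {N : ℕ} {B : Set (Fin (N + 1) → ℝ)} (hB : MeasurableSet B)
    {f : (Fin (N + 1) → ℝ) → ℝ} (hf : IntegrableOn f B) :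
    ∀ᵐ x : Fin N → ℝ, IntegrableOn (fun t : ℝ => f (Fin.snoc x t))
      {t | (Fin.snoc x t : Fin (N + 1) → ℝ) ∈ B} := by
  obtain ⟨e, he, he_symm⟩ := exists_measurableEquiv_snoc N
  have h1 : Integrable (B.indicator f) volume := (integrable_indicator_iff hB).2 hf
  have h2 : Integrable (B.indicator f ∘ e.symm) ((volume : Measure (Fin N → ℝ)).prod volume) :=
    ((he.symm e).integrable_comp_emb e.symm.measurableEmbedding).2 h1
  refine (h2.prod_right_ae).mono fun x hx => ?_
  have hm : MeasurableSet {t : ℝ | (Fin.snoc x t : Fin (N + 1) → ℝ) ∈ B} :=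
    (continuous_snoc x).measurable hB
  refine (integrable_indicator_iff hm).1 (hx.congr (Filter.Eventually.of_forall fun t => ?_))
  show (B.indicator f ∘ e.symm) (x, t) = _
  rw [Function.comp_apply, he_symm]
  exact (Set.indicator_comp_right (fun t : ℝ => (Fin.snoc x t : Fin (N + 1) → ℝ)) (g := f)).symm

/-! (private copy of `false_of_ae_of_forall_not` — dedup.landed / split policy; origin part RootDecompZetaThreeFrontierWordRungTwoP4) -/
/-- an a.e. statement failing on a set of positive volume is absurd -/
private theorem false_of_ae_of_forall_not {N : ℕ} {P : (Fin N → ℝ) → Prop} (h : ∀ᵐ x : Fin N → ℝ, P x)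
    {S : Set (Fin N → ℝ)} (hS : ∀ x ∈ S, ¬ P x) (hvol : volume S ≠ 0) : False := by
  have h0 : volume {x | ¬ P x} = 0 := ae_iff.1 h
  have hle : volume S ≤ volume {x | ¬ P x} := measure_mono fun x hx => hS x hx
  rw [h0] at hle
  exact hvol (nonpos_iff_eq_zero.1 hle)

/-! (private copy of `volume_simplex_ne_zero` — dedup.landed / split policy; origin part RootDecompZetaThreeFrontierWordRungTwoP4) -/
/-- Auxiliary step `volume_simplex_ne_zero`. [bookkeeping] -/
private theorem volume_simplex_ne_zero {N : ℕ} (hne : (KZ.openOrderedSimplex N).Nonempty) :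
    volume (KZ.openOrderedSimplex N) ≠ 0 :=
  (KZ.isOpen_openOrderedSimplex N).measure_ne_zero volume hne

/-! (private copy of `simplex_one_nonempty` — dedup.landed / split policy; origin part RootDecompZetaThreeFrontierWordRungTwoP4) -/
/-- Auxiliary step `simplex_one_nonempty`. [bookkeeping] -/
private theorem simplex_one_nonempty : (KZ.openOrderedSimplex 1).Nonempty :=
  ⟨fun _ => 1 / 2, (mem_simplex_one_iff _).2 ⟨by norm_num, by norm_num⟩⟩

/-! (private copy of `continuous_aeval_fin` — dedup.landed / split policy; origin part RootDecompZetaThreeFrontierWordRungTwoP9a) -/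
/-- Auxiliary step `continuous_aeval_fin`. [bookkeeping] -/
private theorem continuous_aeval_fin {n : ℕ} (p : MvPolynomial (Fin n) ℚ) :
    Continuous fun x : Fin n → ℝ => MvPolynomial.aeval x p := by
  have : (fun x : Fin n → ℝ => MvPolynomial.aeval x p) =
      fun x => MvPolynomial.eval x (MvPolynomial.map (algebraMap ℚ ℝ) p) := by
    funext x; rw [MvPolynomial.eval_map, MvPolynomial.aeval_def]
  rw [this]
  exact MvPolynomial.continuous_eval _

/-- **FACE LEMMA.**  `B` is a measurable cell whose last-coordinate sections over `Δ₁` are the intervals `(0, ℓ(x))`, `0 < ℓ ≤ 1`;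
`D` is non-zero on `B` and, along each section, continuous and non-zero at the face `y₁ = 0`.  If `P(y)/(y₁^b · D(y))` is
integrable on `B` then every monomial of `P` contains `y₁^b`. -/
theorem face_lemma {B : Set (Fin 2 → ℝ)} (hB : MeasurableSet B) (hB1 : ∀ y ∈ B, y 1 ≠ 0) (ℓ : (Fin 1 → ℝ) → ℝ)
    (hsec : ∀ x ∈ KZ.openOrderedSimplex 1, {t : ℝ | (Fin.snoc x t : Fin 2 → ℝ) ∈ B} = Ioo 0 (ℓ x))
    (hℓ : ∀ x ∈ KZ.openOrderedSimplex 1, 0 < ℓ x ∧ ℓ x ≤ 1) (D : (Fin 2 → ℝ) → ℝ)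
    (hDc : ∀ x ∈ KZ.openOrderedSimplex 1, ContinuousAt (fun s : ℝ => D (Fin.snoc x s)) 0)
    (hD0 : ∀ x ∈ KZ.openOrderedSimplex 1, D (Fin.snoc x 0) ≠ 0) :
    ∀ (b : ℕ) (P : MvPolynomial (Fin 2) ℚ),
      IntegrableOn (fun y => MvPolynomial.aeval y P / (y 1 ^ b * D y)) B → ∀ e ∈ P.support, b ≤ e 1 := by
  intro b
  induction b with
  | zero => exact fun P _ e _ => Nat.zero_le _
  | succ b ih =>
    intro P hP
    -- (1) every monomial of `P` contains `y₁`: else the row `P(X,0) ≠ 0` has finitely many roots, and off them the section has a pole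
    have hrow : ∀ e ∈ P.support, 1 ≤ e 1 := by
      by_contra hne
      push Not at hne
      obtain ⟨e₀, he₀, he₀1⟩ := hne
      have he₀1' : e₀ 1 = 0 := Nat.lt_one_iff.1 he₀1
      have hR : rowZero P ≠ 0 := by
        intro h0
        have h1 := coeff_rowZero P (e₀ 0)
        rw [h0, Polynomial.coeff_zero] at h1
        have hee : Finsupp.single (0 : Fin 2) (e₀ 0) = e₀ := by
          ext j; fin_cases j <;> simp [he₀1']
        rw [hee] at h1
        exact (MvPolynomial.mem_support_iff.1 he₀) h1.symm
      have hR0 : (rowZero P).map (algebraMap ℚ ℝ) ≠ 0 :=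
        (Polynomial.map_ne_zero_iff (algebraMap ℚ ℝ).injective).2 hR
      have hfin : Set.Finite {u : ℝ | ((rowZero P).map (algebraMap ℚ ℝ)).IsRoot u} :=
        Polynomial.finite_setOf_isRoot hR0
      have hZfin : ((fun x : Fin 1 → ℝ => x 0) ⁻¹' {u : ℝ | ((rowZero P).map (algebraMap ℚ ℝ)).IsRoot u}).Finite :=
        hfin.preimage fun x _ y _ (h : x 0 = y 0) => funext fun i => by rw [Subsingleton.elim i 0]; exact h
      have hZ0 : volume ((fun x : Fin 1 → ℝ => x 0) ⁻¹' {u : ℝ | ((rowZero P).map (algebraMap ℚ ℝ)).IsRoot u}) = 0 := by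
        haveI : NullSingletonClass (volume : Measure (Fin 1 → ℝ)) := Measure.pi_nullSingletonClass (0 : Fin 1)
        exact hZfin.measure_zero _
      have hae := ae_integrableOn_snoc hB hP
      refine false_of_ae_of_forall_not hae
        (S := KZ.openOrderedSimplex 1 \
          ((fun x : Fin 1 → ℝ => x 0) ⁻¹' {u : ℝ | ((rowZero P).map (algebraMap ℚ ℝ)).IsRoot u}))
        (fun x hx h => ?_) ?_
      · obtain ⟨hxΔ, hxZ⟩ := hx
        obtain ⟨hx0, hx1⟩ := (mem_simplex_one_iff x).1 hxΔ
        rw [hsec x hxΔ] at h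
        -- the section is `M t / t^(b+1)` with `M` continuous and non-zero at `0`
        have hMc : ContinuousAt (fun t : ℝ => MvPolynomial.aeval (Fin.snoc x t : Fin 2 → ℝ) P / D (Fin.snoc x t)) 0 :=
          ((continuous_aeval_fin P).comp (continuous_snoc x)).continuousAt.div₀ (hDc x hxΔ) (hD0 x hxΔ)
        have hM0 : (fun t : ℝ => MvPolynomial.aeval (Fin.snoc x t : Fin 2 → ℝ) P / D (Fin.snoc x t)) 0 ≠ 0 := by
          refine div_ne_zero ?_ (hD0 x hxΔ)
          rw [aeval_rowZero P (show (Fin.snoc x (0:ℝ) : Fin 2 → ℝ) 1 = 0 from rfl)]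
          show Polynomial.aeval (x 0) (rowZero P) ≠ 0
          rw [Polynomial.aeval_def, ← Polynomial.eval_map]
          exact hxZ
        obtain ⟨η, hη, hη1, hMη⟩ := abs_ge_near_zero hMc hM0
        have hη' : 0 < min η (ℓ x) := lt_min hη (hℓ x hxΔ).1
        refine not_integrableOn_pole (half_pos (abs_pos.2 hM0)) hη' ((min_le_left _ _).trans hη1)
          (Nat.succ_le_succ b.zero_le) (fun y hy => hMη y ⟨hy.1, hy.2.trans_le (min_le_left _ _)⟩)
          ((h.mono_set (Ioo_subset_Ioo_right (min_le_right _ _))).congr_fun (fun t _ => ?_) measurableSet_Ioo)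
        show MvPolynomial.aeval (Fin.snoc x t : Fin 2 → ℝ) P /
            ((Fin.snoc x t : Fin 2 → ℝ) 1 ^ (b + 1) * D (Fin.snoc x t)) =
          MvPolynomial.aeval (Fin.snoc x t : Fin 2 → ℝ) P / D (Fin.snoc x t) / t ^ (b + 1)
        rw [div_div, mul_comm (D _)]
        rfl
      · rw [measure_sdiff_null hZ0]
        exact volume_simplex_ne_zero simplex_one_nonempty
    -- (2) cancel one factor `y₁` and recurse
    obtain ⟨P', rfl⟩ := exists_X_pow_mul 1 1 P hrow
    have hP' : IntegrableOn (fun y => MvPolynomial.aeval y P' / (y 1 ^ b * D y)) B := by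
      refine hP.congr_fun (fun y hy => ?_) hB
      show MvPolynomial.aeval y (MvPolynomial.X 1 ^ 1 * P') / (y 1 ^ (b + 1) * D y) =
        MvPolynomial.aeval y P' / (y 1 ^ b * D y)
      rw [map_mul, map_pow, MvPolynomial.aeval_X, pow_one, pow_succ', mul_assoc, mul_div_mul_left _ _ (hB1 y hy)]
    have ih' := ih P' hP'
    intro e he
    obtain ⟨h1, he'⟩ := le_of_mem_support_X_pow_mul 1 1 P' e he
    have := ih' _ he'
    simp only [Finsupp.coe_tsub, Pi.sub_apply, Finsupp.single_eq_same] at this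
    omega

/-! ### 21c  Transport of integrability: the involutions `σ`, `τ` of `Δ₂` and the blow-up chart `Ψ(s,t) = (t, ts)` -/

/-- Auxiliary step `hasFDerivAt_spΦ`. [bookkeeping] -/
theorem hasFDerivAt_spΦ (x : Fin 2 → ℝ) : HasFDerivAt spΦ spL x := by
  have h : HasFDerivAt (fun z : Fin 2 → ℝ => (fun _ => (1 : ℝ)) + spL z) spL x := (spL.hasFDerivAt).const_add _
  have e : spΦ = fun z : Fin 2 → ℝ => (fun _ => (1 : ℝ)) + spL z := funext spΦ_eq
  rw [e]
  exact h

/-- Auxiliary step `injOn_spΦ`. [bookkeeping] -/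
theorem injOn_spΦ (s : Set (Fin 2 → ℝ)) : InjOn spΦ s := fun a _ b _ h => by
  have := congrArg spΦ h
  rwa [spΦ_spΦ, spΦ_spΦ] at this

/-- `F` integrable on `Δ₂` ⟹ `F ∘ σ` integrable on `Δ₂` (`|det σ| = 1`, `σ(Δ₂) = Δ₂`) -/
theorem integrableOn_comp_spΦ {F : (Fin 2 → ℝ) → ℝ} (hF : IntegrableOn F (KZ.openOrderedSimplex 2)) :
    IntegrableOn (fun z => F (spΦ z)) (KZ.openOrderedSimplex 2) := by
  have hm := measurableSet_simplex 2
  have key := (integrableOn_image_iff_integrableOn_abs_det_fderiv_smul (μ := volume) hm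
    (fun x _ => (hasFDerivAt_spΦ x).hasFDerivWithinAt) (injOn_spΦ _) (fun z => F (spΦ z))).2
    (hF.congr_fun (fun p _ => by simp [abs_det_spL, spΦ_spΦ]) hm)
  rwa [image_spΦ] at key

/-- the shear involution `τ(t₀,t₁) = (t₀, t₀ - t₁)` of `Δ₂` (it exchanges the faces `t₁ = 0` and `t₁ = t₀`) -/
def shΦ (z : Fin 2 → ℝ) : Fin 2 → ℝ := ![z 0, z 0 - z 1]

/-- `τ` as a continuous linear map -/
def shL : (Fin 2 → ℝ) →L[ℝ] (Fin 2 → ℝ) :=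
  ContinuousLinearMap.pi ![ContinuousLinearMap.proj (R := ℝ) (φ := fun _ : Fin 2 => ℝ) 0,
    ContinuousLinearMap.proj (R := ℝ) (φ := fun _ : Fin 2 => ℝ) 0 -
      ContinuousLinearMap.proj (R := ℝ) (φ := fun _ : Fin 2 => ℝ) 1]

/-- Auxiliary step `shΦ_zero`. [bookkeeping] -/
theorem shΦ_zero (z : Fin 2 → ℝ) : shΦ z 0 = z 0 := by simp [shΦ]

/-- Auxiliary step `shΦ_one`. [bookkeeping] -/
theorem shΦ_one (z : Fin 2 → ℝ) : shΦ z 1 = z 0 - z 1 := by simp [shΦ]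

/-- Auxiliary step `shL_apply_zero`. [bookkeeping] -/
theorem shL_apply_zero (w : Fin 2 → ℝ) : shL w 0 = w 0 := by simp [shL]

/-- Auxiliary step `shL_apply_one`. [bookkeeping] -/
theorem shL_apply_one (w : Fin 2 → ℝ) : shL w 1 = w 0 - w 1 := by simp [shL]

/-- Auxiliary step `shΦ_eq_shL`. [bookkeeping] -/
theorem shΦ_eq_shL (z : Fin 2 → ℝ) : shΦ z = shL z := by
  funext i
  fin_cases i
  · simp [shΦ_zero, shL_apply_zero]
  · simp [shΦ_one, shL_apply_one]

/-- Auxiliary step `shΦ_shΦ`. [bookkeeping] -/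
theorem shΦ_shΦ (z : Fin 2 → ℝ) : shΦ (shΦ z) = z := by
  funext i
  fin_cases i <;> simp [shΦ_zero, shΦ_one]

/-- Auxiliary step `shL_shL`. [bookkeeping] -/
theorem shL_shL (w : Fin 2 → ℝ) : shL (shL w) = w := by
  rw [← shΦ_eq_shL, ← shΦ_eq_shL, shΦ_shΦ]

/-- Auxiliary step `abs_det_shL`. [bookkeeping] -/
theorem abs_det_shL : |shL.det| = 1 := by
  have hcomp : (shL : (Fin 2 → ℝ) →ₗ[ℝ] (Fin 2 → ℝ)) ∘ₗ (shL : (Fin 2 → ℝ) →ₗ[ℝ] (Fin 2 → ℝ)) =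
      LinearMap.id := by
    apply LinearMap.ext
    intro w
    simp [shL_shL]
  have h := congrArg LinearMap.det hcomp
  rw [LinearMap.det_comp, LinearMap.det_id] at h
  have h2 : |LinearMap.det (shL : (Fin 2 → ℝ) →ₗ[ℝ] (Fin 2 → ℝ))| ^ 2 = 1 := by
    rw [sq_abs, sq, h]
  exact (pow_eq_one_iff_of_nonneg (abs_nonneg _) two_ne_zero).1 h2

/-- Auxiliary step `hasFDerivAt_shΦ`. [bookkeeping] -/
theorem hasFDerivAt_shΦ (x : Fin 2 → ℝ) : HasFDerivAt shΦ shL x := by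
  have e : shΦ = fun z => shL z := funext shΦ_eq_shL
  rw [e]
  exact shL.hasFDerivAt

/-- Membership in `simplex_two_shΦ`, unfolded. [bookkeeping] -/
theorem mem_simplex_two_shΦ {z : Fin 2 → ℝ} (hz : z ∈ KZ.openOrderedSimplex 2) :
    shΦ z ∈ KZ.openOrderedSimplex 2 := by
  rw [mem_simplex_two_iff] at hz ⊢
  rw [shΦ_zero, shΦ_one]
  obtain ⟨h1, h10, h0⟩ := hz
  exact ⟨by linarith, by linarith, h0⟩

end Necessity
end Summit.KontsevichZagierPeriods.RootDecompZetaThreeFrontier.WordLayer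
end

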